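import Mathlib
import Summits.Ventures.HodgeRepro2.Tier7.Line3.UnramifiedPlaceCompletion
import Summits.Ventures.HodgeRepro2.Tier7.Line3.DoubleCosetCover
import Summits.Ventures.HodgeRepro2.Tier7.Line3.AdicCompletionLevel

/-!
# Tier7/Line3/IntegralSubgroupBridge — the two `GL₂(𝓞)` of the tree coincide on Mathlib's completion
(seat t7-x1, gen 5; crit-2 STATUS l. 16278 (B)(1): «a one-line bridge for a later row»)

LINE 3 (t7-plan-3), version (ii). The tree has two integral subgroups of `GL₂(F)`: DoubleCosetCover's
`integralSubgroup (O : Subring F)` (L1-p2, p714118: entries of `g` and `g⁻¹` in the subring `O`) and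
UnramifiedPlaceCompletion's `integralSubgroupAbv abv hna` (p718753: entries of `g` and `g⁻¹` of absolute value `≤ 1`).
On Mathlib's completion `F := v.adicCompletion K` with `abv := normAbv` (Mathlib's normalised norm) and `O :=` the
valuation ring `Valued.v.integer` (= `(v.adicCompletionIntegers K).toSubring`) they are the SAME subgroup:
`‖x‖ ≤ 1 ↔ Valued.v x ≤ 1` (AdicCompletionLevel's `norm_le_pow_iff` at `n = 0`, p705534) entrywise. So the split-place
rows (DoubleCosetCover / CoverCountLink / CartanDecomposition, over `O`) and the unramified-place row (over `abv`) speak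
of ONE `K_w = GL₂(𝓞_w)`. [M]-level; NOT distance to (P); residual (a′)/(b′) unchanged in kind. Nothing here is about
(N), (P), the real `X`, or HC_CM; §8(d): NO. Blind lane: Mathlib + the HodgeRepro2 prefix; no sorry;
axioms ⊆ {propext, Classical.choice, Quot.sound}.
-/

namespace Summit.Ventures.HodgeRepro2.Tier7.Line3.IntegralSubgroupBridge

open IsDedekindDomain IsDedekindDomain.HeightOneSpectrum NumberField WithZero
  Summit.Ventures.HodgeRepro2.Tier7.Line3.LevelTowerTopology
  Summit.Ventures.HodgeRepro2.Tier7.Line3.CongruenceSubgroup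
  Summit.Ventures.HodgeRepro2.Tier7.Line3.AdicCompletionLevel
  Summit.Ventures.HodgeRepro2.Tier7.Line3.UnramifiedPlaceCompletion
  Summit.Ventures.HodgeRepro2.Tier7.Line3.DoubleCosetCover
open scoped NumberField WithZero

variable {K : Type*} [Field K] [NumberField K] (v : HeightOneSpectrum (𝓞 K))

/-- **`‖x‖ ≤ 1 ↔ Valued.v x ≤ 1`** on the completion (p705534's `norm_le_pow_iff` at `n = 0`). ONE NORM INSTANCE
(crit-2 STATUS l. 16290 (B)(1)): the `NormedField` instance on `v.adicCompletion K` is Mathlib's own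
(`NumberField/Completion/FinitePlace.lean`: `‖x‖ = toNNReal (absNorm v) (Valued.v x)`, `FinitePlace.norm_def`);
AdicCompletionLocalField (p703140) declares no norm instance (only `IsUltrametricDist` / `ProperSpace`), and this
file declares none — `normAbv` in p718753 and `‖·‖` here read the same instance. -/
theorem norm_le_one_iff (x : v.adicCompletion K) : ‖x‖ ≤ 1 ↔ Valued.v x ≤ 1 := by
  have h := norm_le_pow_iff v x 0
  rwa [pow_zero, Nat.cast_zero, neg_zero, exp_zero] at h

/-- **`‖x‖ ≤ 1 ↔ x ∈ 𝓞_v`**: the unit ball of the norm is the valuation ring. -/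
theorem norm_le_one_iff_mem_integer (x : v.adicCompletion K) : ‖x‖ ≤ 1 ↔ x ∈ (Valued.v : Valuation (v.adicCompletion K) ℤᵐ⁰).integer := by
  rw [norm_le_one_iff, Valuation.mem_integer_iff]

/-- **the two integral subgroups coincide**: `integralSubgroupAbv normAbv _ = integralSubgroup Valued.v.integer` on the
completion (`Subgroup.ext`, entrywise by `norm_le_one_iff_mem_integer` both ways; both sides ask the entries of `g`
AND of `g⁻¹`). This identifies the `K_w` of the split rows AT THE MODEL — the rows specialised to `Valued.v` on the
completion — with p718753's; the split rows stated over an ABSTRACT valuation `v : Valuation F ℤᵐ⁰` stay abstract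
(crit-2 STATUS l. 16290 (B)(2)). -/
theorem integralSubgroupAbv_eq_integralSubgroup :
    integralSubgroupAbv (normAbv : AbsoluteValue (v.adicCompletion K) ℝ) isNonarchimedean_normAbv =
      integralSubgroup (Valued.v : Valuation (v.adicCompletion K) ℤᵐ⁰).integer := by
  ext g
  rw [mem_integralSubgroupAbv, mem_integralSubgroup]
  unfold EntryLE
  simp only [normAbv_apply, norm_le_one_iff_mem_integer]

/-- the same with the valuation ring written as Mathlib's `adicCompletionIntegers` —
`(v.adicCompletionIntegers K).toSubring = Valued.v.integer` DEFINITIONALLY (`adicCompletionIntegers := Valued.v.valuationSubring`,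
whose `toSubring` is `Valued.v.integer`): the proof term is the previous theorem unchanged (crit-2 STATUS l. 16290
(B)(3)). -/
theorem integralSubgroupAbv_eq_integralSubgroup' :
    integralSubgroupAbv (normAbv : AbsoluteValue (v.adicCompletion K) ℝ) isNonarchimedean_normAbv =
      integralSubgroup (v.adicCompletionIntegers K).toSubring :=
  integralSubgroupAbv_eq_integralSubgroup v

end Summit.Ventures.HodgeRepro2.Tier7.Line3.IntegralSubgroupBridge
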